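import Summits.CriticalPhenomena.PercolationContinuityZ3.Theorems.PercNearOneGluingNoHeavyLowerTailStarPatternForcing
import HarnessLib

/-!
# `NoHeavyLowerTail` (stmt-CriticalPhenomena-4575) — bridge from a FORCED STAR at a one-layer observer to the core with
# the pattern glued

Support file (lemma factory `prim-lf-3` gen 7, seat g9; `--supports stmt-CriticalPhenomena-4575`).  No definitions, no
named facts, no sorries.  Memo: `run/shared/lean/prim/prim-lf-3/LF3-BETA-R.md` §8 (assembly step (2)).

* `real_openConn_gluePairs_of_asJoined` — raising to `1` a finite set of pairs whose endpoints are already almost surely joined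
  does not change any `μ(z ↔ b)`.
* `real_openConn_attachPendant` / `real_openConn_attachPendant_self` — attaching an almost surely isolated vertex `o` to `t₀` by a sure
  pair does not change `μ(z ↔ b)` for `z, b ≠ o`, and makes `μ(o ↔ b) = μ(t₀ ↔ b)`.
* `real_openConn_forcedStar_eq` / `…_self` — the BRIDGE: let `K` have `o` almost surely isolated (`K s(o,u) = 0` for all `u`), `T` a pattern,
  `t₀ ∈ T`, and `S` a finite set of pairs inside `T` such that `K[S ↦ 1]` joins `t₀` to every `t ∈ T` almost surely.  Then the forced star
  `K[S ↦ 1][s(o,t), t ∈ T ↦ 1]` and … more simply the forced star `K[s(o,t), t ∈ T ↦ 1]` satisfy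
  `μ_{K[star T ↦ 1]}(z ↔ b) = μ_{K[S ↦ 1]}(z ↔ b)` (`z, b ≠ o`) and `μ_{K[star T ↦ 1]}(o ↔ b) = μ_{K[S ↦ 1]}(t₀ ↔ b)`.
  (Common refinement `K[S ↦ 1][star ↦ 1]`; both reductions are the two lemmas above.)
-/

namespace Summit.CriticalPhenomena.PercolationContinuityZ3.Theorems

open MeasureTheory Set ProbabilityTheory
open Literature.Probability.LatticeModels
open Literature.Probability.Percolation

noncomputable section
open Classical

namespace UpsetExchange

variable {n : ℕ}

/-- **Sure pairs between almost surely joined endpoints change nothing.** [folklore] -/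
theorem real_openConn_gluePairs_of_asJoined (g : Sym2 (Fin n) → unitInterval) (D : Finset (Sym2 (Fin n)))
    (hD : ∀ e ∈ D, ∀ x ∈ e, ∀ y ∈ e, (prodBernoulli g).real (openConn x y)ᶜ = 0) (z b : Fin n) :
    (prodBernoulli (fun f : Sym2 (Fin n) => if f ∈ D then 1 else g f)).real (openConn z b) =
      (prodBernoulli g).real (openConn z b) := by
  rw [glueSet_pushforward g (fun f : Sym2 (Fin n) => if f ∈ D then 1 else g f) (↑D)
    (fun f hf => by simp [Finset.mem_coe.1 hf]) (fun f hf => by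
      have : f ∉ D := fun h => hf (Finset.mem_coe.2 h)
      simp [this])]
  set A : Set (BondConfig (Fin n)) := {ω | ((ω ∪ (↑D : Set (Sym2 (Fin n)))) : BondConfig (Fin n)) ∈ (openConn z b : Set _)} with hA
  set N : Set (BondConfig (Fin n)) := ⋃ e ∈ D, {ω : BondConfig (Fin n) | ¬ ∀ x ∈ e, ∀ y ∈ e, (openGraph ω).Reachable x y} with hN
  have hN0 : (prodBernoulli g).real N = 0 := by
    apply le_antisymm _ measureReal_nonneg
    refine (measureReal_biUnion_finset_le D _).trans (le_of_eq (Finset.sum_eq_zero fun e he => ?_))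
    apply le_antisymm _ measureReal_nonneg
    induction e using Sym2.ind with
    | h x y =>
      have hsub : {ω : BondConfig (Fin n) | ¬ ∀ x' ∈ s(x, y), ∀ y' ∈ s(x, y), (openGraph ω).Reachable x' y'} ⊆
          (openConn x y)ᶜ ∪ (openConn y x)ᶜ := by
        intro ω hω
        simp only [mem_setOf_eq, not_forall] at hω
        obtain ⟨x', hx', y', hy', hr⟩ := hω
        simp only [mem_union, mem_compl_iff]
        rcases Sym2.mem_iff.1 hx' with rfl | rfl <;> rcases Sym2.mem_iff.1 hy' with rfl | rfl
        · exact absurd (SimpleGraph.Reachable.refl _) hr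
        · exact Or.inl hr
        · exact Or.inr hr
        · exact absurd (SimpleGraph.Reachable.refl _) hr
      have h1 := hD _ he x (Sym2.mem_mk_left x y) y (Sym2.mem_mk_right x y)
      have h2 := hD _ he y (Sym2.mem_mk_right x y) x (Sym2.mem_mk_left x y)
      calc (prodBernoulli g).real _ ≤ (prodBernoulli g).real ((openConn x y)ᶜ ∪ (openConn y x)ᶜ) :=
            measureReal_mono hsub (measure_ne_top _ _)
        _ ≤ (prodBernoulli g).real (openConn x y)ᶜ + (prodBernoulli g).real (openConn y x)ᶜ := measureReal_union_le _ _
        _ = 0 := by rw [h1, h2, add_zero]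
  have hsub1 : (openConn z b : Set (BondConfig (Fin n))) ⊆ A := fun ω hω =>
    (hω : (openGraph ω).Reachable z b).mono (openGraph_mono subset_union_left)
  have hsub2 : A ⊆ openConn z b ∪ N := by
    intro ω hω
    by_cases hn : ω ∈ N
    · exact Or.inr hn
    · left
      have hall : ∀ e ∈ D, ∀ x ∈ e, ∀ y ∈ e, (openGraph ω).Reachable x y := by
        intro e he x hx y hy
        by_contra hc
        exact hn (mem_iUnion₂.2 ⟨e, he, fun h => hc (h x hx y hy)⟩)
      exact reachable_of_union_joined ω D z b hall hω
  apply le_antisymm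
  · calc (prodBernoulli g).real A ≤ (prodBernoulli g).real (openConn z b ∪ N) := measureReal_mono hsub2 (measure_ne_top _ _)
      _ ≤ (prodBernoulli g).real (openConn z b) + (prodBernoulli g).real N := measureReal_union_le _ _
      _ = (prodBernoulli g).real (openConn z b) := by rw [hN0, add_zero]
  · exact measureReal_mono hsub1 (measure_ne_top _ _)

/-- An almost surely isolated vertex is almost surely not joined to anybody else. [folklore] -/
theorem real_openConn_isolated_eq_zero (g : Sym2 (Fin n) → unitInterval) (o : Fin n)
    (hiso : ∀ u : Fin n, u ≠ o → g s(o, u) = 0) (z : Fin n) (hz : z ≠ o) :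
    (prodBernoulli g).real (openConn o z) = 0 := by
  set N : Set (BondConfig (Fin n)) := ⋃ u ∈ Finset.univ.filter (fun u : Fin n => u ≠ o), {ω : BondConfig (Fin n) | s(o, u) ∈ ω}
  have hsub : (openConn o z : Set (BondConfig (Fin n))) ⊆ N := by
    intro ω hω
    obtain ⟨p⟩ := (hω : (openGraph ω).Reachable o z)
    cases p with
    | nil => exact absurd rfl hz
    | @cons _ u _ hadj _ =>
      have h := (openGraph_adj ω o u).1 hadj
      exact mem_iUnion₂.2 ⟨u, Finset.mem_filter.2 ⟨Finset.mem_univ _, fun h' => h.2 h'.symm⟩, h.1⟩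
  apply le_antisymm _ measureReal_nonneg
  refine (measureReal_mono hsub (measure_ne_top _ _)).trans ?_
  refine (measureReal_biUnion_finset_le _ _).trans (le_of_eq (Finset.sum_eq_zero fun u hu => ?_))
  rw [prodBernoulli_real_setOf_mem, hiso u (Finset.mem_filter.1 hu).2]
  rfl

/-- **Attaching a pendant to an almost surely isolated vertex**, other vertices: `μ_{g[s(o,t₀)↦1]}(z ↔ b) = μ_g(z ↔ b)` for `z, b ≠ o`.
[folklore] -/
theorem real_openConn_attachPendant (g : Sym2 (Fin n) → unitInterval) (o t₀ : Fin n) (hot : o ≠ t₀)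
    (hiso : ∀ u : Fin n, u ≠ o → g s(o, u) = 0) (z b : Fin n) (hz : z ≠ o) (hb : b ≠ o) :
    (prodBernoulli (fun f : Sym2 (Fin n) => if f = s(o, t₀) then 1 else g f)).real (openConn z b) =
      (prodBernoulli g).real (openConn z b) := by
  rw [glueSet_pushforward g (fun f : Sym2 (Fin n) => if f = s(o, t₀) then 1 else g f) {s(o, t₀)}
    (fun f hf => by rw [mem_singleton_iff.1 hf]; simp) (fun f hf => by
      have : f ≠ s(o, t₀) := fun h => hf (h ▸ mem_singleton _)
      simp [this])]
  have hset : {ω : BondConfig (Fin n) | ((ω ∪ {s(o, t₀)} : Set (Sym2 (Fin n))) : BondConfig (Fin n)) ∈ (openConn z b : Set _)} =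
      openConn z b ∪ (openConn z o ∩ openConn t₀ b) ∪ (openConn z t₀ ∩ openConn o b) := by
    ext ω
    simp only [mem_setOf_eq, mem_union, mem_inter_iff]
    constructor
    · intro h
      rcases WeakestPort.reachable_union_pair (x := o) (y := t₀) (h : (openGraph _).Reachable z b) with h1 | ⟨h2, h3⟩ | ⟨h2, h3⟩
      · exact Or.inl (Or.inl h1)
      · exact Or.inl (Or.inr ⟨h2, h3⟩)
      · exact Or.inr ⟨h2, h3⟩
    · rintro ((h | ⟨h2, h3⟩) | ⟨h2, h3⟩)
      · exact WeakestPort.reachable_union_pair_of hot (Or.inl h)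
      · exact WeakestPort.reachable_union_pair_of hot (Or.inr (Or.inl ⟨h2, h3⟩))
      · exact WeakestPort.reachable_union_pair_of hot (Or.inr (Or.inr ⟨h2, h3⟩))
  rw [hset]
  have hzo : (prodBernoulli g).real (openConn z o) = 0 := by
    have : (openConn z o : Set (BondConfig (Fin n))) = openConn o z :=
      Set.ext fun _ => ⟨fun h => SimpleGraph.Reachable.symm h, fun h => SimpleGraph.Reachable.symm h⟩
    rw [this]; exact real_openConn_isolated_eq_zero g o hiso z hz
  have hob : (prodBernoulli g).real (openConn o b) = 0 := real_openConn_isolated_eq_zero g o hiso b hb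
  apply le_antisymm
  · calc (prodBernoulli g).real (openConn z b ∪ (openConn z o ∩ openConn t₀ b) ∪ (openConn z t₀ ∩ openConn o b))
        ≤ (prodBernoulli g).real (openConn z b ∪ (openConn z o ∩ openConn t₀ b)) + (prodBernoulli g).real (openConn z t₀ ∩ openConn o b) :=
          measureReal_union_le _ _
      _ ≤ ((prodBernoulli g).real (openConn z b) + (prodBernoulli g).real (openConn z o ∩ openConn t₀ b)) +
            (prodBernoulli g).real (openConn z t₀ ∩ openConn o b) := by
          have := measureReal_union_le (μ := prodBernoulli g) (openConn z b : Set (BondConfig (Fin n))) (openConn z o ∩ openConn t₀ b)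
          linarith
      _ ≤ (prodBernoulli g).real (openConn z b) + (prodBernoulli g).real (openConn z o) + (prodBernoulli g).real (openConn o b) := by
          have m1 := measureReal_mono (inter_subset_left : (openConn z o ∩ openConn t₀ b : Set (BondConfig (Fin n))) ⊆ openConn z o)
            (measure_ne_top (prodBernoulli g) _)
          have m2 := measureReal_mono (inter_subset_right : (openConn z t₀ ∩ openConn o b : Set (BondConfig (Fin n))) ⊆ openConn o b)
            (measure_ne_top (prodBernoulli g) _)
          linarith
      _ = (prodBernoulli g).real (openConn z b) := by rw [hzo, hob]; ring
  · exact measureReal_mono (subset_union_left.trans subset_union_left) (measure_ne_top _ _)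

/-- **Attaching a pendant to an almost surely isolated vertex**, the vertex itself: `μ_{g[s(o,t₀)↦1]}(o ↔ b) = μ_g(t₀ ↔ b)` for `b ≠ o`.
[folklore] -/
theorem real_openConn_attachPendant_self (g : Sym2 (Fin n) → unitInterval) (o t₀ : Fin n) (hot : o ≠ t₀)
    (hiso : ∀ u : Fin n, u ≠ o → g s(o, u) = 0) (b : Fin n) (hb : b ≠ o) :
    (prodBernoulli (fun f : Sym2 (Fin n) => if f = s(o, t₀) then 1 else g f)).real (openConn o b) =
      (prodBernoulli g).real (openConn t₀ b) := by
  rw [glueSet_pushforward g (fun f : Sym2 (Fin n) => if f = s(o, t₀) then 1 else g f) {s(o, t₀)}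
    (fun f hf => by rw [mem_singleton_iff.1 hf]; simp) (fun f hf => by
      have : f ≠ s(o, t₀) := fun h => hf (h ▸ mem_singleton _)
      simp [this])]
  have hset : {ω : BondConfig (Fin n) | ((ω ∪ {s(o, t₀)} : Set (Sym2 (Fin n))) : BondConfig (Fin n)) ∈ (openConn o b : Set _)} =
      openConn t₀ b ∪ openConn o b := by
    ext ω
    simp only [mem_setOf_eq, mem_union]
    constructor
    · intro h
      rcases WeakestPort.reachable_union_pair (x := o) (y := t₀) (h : (openGraph _).Reachable o b) with h1 | ⟨-, h3⟩ | ⟨-, h3⟩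
      · exact Or.inr h1
      · exact Or.inl h3
      · exact Or.inr h3
    · rintro (h | h)
      · exact WeakestPort.reachable_union_pair_of hot (Or.inr (Or.inl ⟨SimpleGraph.Reachable.refl _, h⟩))
      · exact WeakestPort.reachable_union_pair_of hot (Or.inl h)
  rw [hset]
  have hob : (prodBernoulli g).real (openConn o b) = 0 := real_openConn_isolated_eq_zero g o hiso b hb
  apply le_antisymm
  · calc (prodBernoulli g).real (openConn t₀ b ∪ openConn o b) ≤ (prodBernoulli g).real (openConn t₀ b) + (prodBernoulli g).real (openConn o b) :=
          measureReal_union_le _ _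
      _ = (prodBernoulli g).real (openConn t₀ b) := by rw [hob, add_zero]
  · exact measureReal_mono subset_union_left (measure_ne_top _ _)

/-- `x ↔ y` almost surely when both are joined to `o` by weight-one pairs. [folklore] -/
theorem real_not_openConn_eq_zero_of_hub (g : Sym2 (Fin n) → unitInterval) (o x y : Fin n) (hx : x ≠ o) (hy : y ≠ o)
    (h1 : g s(o, x) = 1) (h2 : g s(o, y) = 1) : (prodBernoulli g).real (openConn x y)ᶜ = 0 := by
  have hsub : ((openConn x y)ᶜ : Set (BondConfig (Fin n))) ⊆ {ω | s(o, x) ∉ ω} ∪ {ω | s(o, y) ∉ ω} := by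
    intro ω hω
    by_contra hc
    simp only [mem_union, mem_setOf_eq, not_or, not_not] at hc
    apply hω
    have a1 : (openGraph ω).Adj x o := (openGraph_adj ω x o).2 ⟨by rw [Sym2.eq_swap]; exact hc.1, hx⟩
    have a2 : (openGraph ω).Adj o y := (openGraph_adj ω o y).2 ⟨hc.2, hy.symm⟩
    exact a1.reachable.trans a2.reachable
  apply le_antisymm _ measureReal_nonneg
  refine (measureReal_mono hsub (measure_ne_top _ _)).trans ((measureReal_union_le _ _).trans (le_of_eq ?_))
  rw [prodBernoulli_real_setOf_notMem, prodBernoulli_real_setOf_notMem, h1, h2]; simp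

/-- **Bridge: forced star versus glued core.**  See the module docstring. [folklore] -/
theorem real_openConn_forcedStar_eq (K : Sym2 (Fin n) → unitInterval) (o : Fin n)
    (hiso : ∀ u : Fin n, u ≠ o → K s(o, u) = 0) (T : Finset (Fin n)) (hoT : o ∉ T) (t₀ : Fin n) (ht₀ : t₀ ∈ T)
    (S : Finset (Sym2 (Fin n))) (hS : ∀ e ∈ S, ∀ x ∈ e, x ∈ T)
    (hconn : ∀ t ∈ T, (prodBernoulli (fun f : Sym2 (Fin n) => if f ∈ S then 1 else K f)).real (openConn t₀ t)ᶜ = 0)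
    (z b : Fin n) (hb : b ≠ o) :
    ((z ≠ o → (prodBernoulli (fun f : Sym2 (Fin n) => if f ∈ T.image (fun t => s(o, t)) then 1 else K f)).real (openConn z b) =
        (prodBernoulli (fun f : Sym2 (Fin n) => if f ∈ S then 1 else K f)).real (openConn z b)) ∧
      ((prodBernoulli (fun f : Sym2 (Fin n) => if f ∈ T.image (fun t => s(o, t)) then 1 else K f)).real (openConn o b) =
        (prodBernoulli (fun f : Sym2 (Fin n) => if f ∈ S then 1 else K f)).real (openConn t₀ b))) := by
  set D : Finset (Sym2 (Fin n)) := T.image (fun t => s(o, t)) with hD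
  set Wst : Sym2 (Fin n) → unitInterval := fun f => if f ∈ D then 1 else K f with hWst
  set Ksp : Sym2 (Fin n) → unitInterval := fun f => if f ∈ S then 1 else K f with hKsp
  set Ksp1 : Sym2 (Fin n) → unitInterval := fun f => if f = s(o, t₀) then 1 else Ksp f with hKsp1
  set V : Sym2 (Fin n) → unitInterval := fun f => if f ∈ S then 1 else Wst f with hV
  have hot₀ : o ≠ t₀ := fun h => hoT (h ▸ ht₀)
  have hDmem : ∀ f, f ∈ D ↔ ∃ t ∈ T, f = s(o, t) := by
    intro f; simp only [hD, Finset.mem_image]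
    constructor
    · rintro ⟨t, ht, rfl⟩; exact ⟨t, ht, rfl⟩
    · rintro ⟨t, ht, rfl⟩; exact ⟨t, ht, rfl⟩
  have hSD : ∀ f ∈ S, f ∉ D := by
    intro f hf hfD
    obtain ⟨t, -, rfl⟩ := (hDmem f).1 hfD
    exact hoT (hS _ hf o (Sym2.mem_mk_left o t))
  -- the common refinement, built from the other side
  have hV' : V = fun f => if f ∈ D then 1 else Ksp1 f := by
    funext f
    simp only [hV, hWst, hKsp1, hKsp]
    by_cases h1 : f ∈ S
    · rw [if_pos h1, if_neg (hSD f h1)]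
      have : f ≠ s(o, t₀) := fun h => hSD f h1 ((hDmem f).2 ⟨t₀, ht₀, h⟩)
      rw [if_neg this, if_pos h1]
    · rw [if_neg h1]
      by_cases h2 : f ∈ D
      · rw [if_pos h2, if_pos h2]
      · rw [if_neg h2, if_neg h2]
        have : f ≠ s(o, t₀) := fun h => h2 ((hDmem f).2 ⟨t₀, ht₀, h⟩)
        rw [if_neg this, if_neg h1]
  -- Step A: `V` versus the forced star (pairs of `S` have a.s. joined endpoints under the star)
  have hA : ∀ x y' : Fin n, (prodBernoulli V).real (openConn x y') = (prodBernoulli Wst).real (openConn x y') := by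
    intro x y'
    refine real_openConn_gluePairs_of_asJoined Wst S (fun e he a ha c hc => ?_) x y'
    by_cases hac : a = c
    · subst hac
      have : ((openConn a a)ᶜ : Set (BondConfig (Fin n))) = ∅ := by
        ext ω; simp only [mem_compl_iff, mem_empty_iff_false, iff_false, not_not]
        exact (SimpleGraph.Reachable.refl a : (openGraph ω).Reachable a a)
      rw [this, measureReal_empty]
    · have haT := hS e he a ha
      have hcT := hS e he c hc
      have hao : a ≠ o := fun h => hoT (h ▸ haT)
      have hco : c ≠ o := fun h => hoT (h ▸ hcT)
      refine real_not_openConn_eq_zero_of_hub Wst o a c hao hco ?_ ?_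
      · simp only [hWst, if_pos ((hDmem _).2 ⟨a, haT, rfl⟩)]
      · simp only [hWst, if_pos ((hDmem _).2 ⟨c, hcT, rfl⟩)]
  -- Step B: `V` versus `Ksp`: attach `o` to `t₀`, then add the other star pairs
  have hisoKsp : ∀ u : Fin n, u ≠ o → Ksp s(o, u) = 0 := by
    intro u hu
    have : s(o, u) ∉ S := fun h => hoT (hS _ h o (Sym2.mem_mk_left o u))
    simp only [hKsp, if_neg this, hiso u hu]
  have hB : ∀ x y' : Fin n, (prodBernoulli V).real (openConn x y') = (prodBernoulli Ksp1).real (openConn x y') := by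
    intro x y'
    rw [hV']
    refine real_openConn_gluePairs_of_asJoined Ksp1 D (fun e he a ha c hc => ?_) x y'
    obtain ⟨t, ht, rfl⟩ := (hDmem e).1 he
    have hto : t ≠ o := fun h => hoT (h ▸ ht)
    -- `o ~ t₀` surely and `t₀ ~ t` a.s. under `Ksp1`
    have h_ot₀ : (prodBernoulli Ksp1).real (openConn o t₀)ᶜ = 0 := by
      have hsub : ((openConn o t₀)ᶜ : Set (BondConfig (Fin n))) ⊆ {ω | s(o, t₀) ∉ ω} := by
        intro ω hω hmem
        exact hω (((openGraph_adj ω o t₀).2 ⟨hmem, hot₀⟩).reachable)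
      apply le_antisymm _ measureReal_nonneg
      refine (measureReal_mono hsub (measure_ne_top _ _)).trans (le_of_eq ?_)
      rw [prodBernoulli_real_setOf_notMem]; simp [hKsp1]
    have h_t₀t : (prodBernoulli Ksp1).real (openConn t₀ t)ᶜ = 0 := by
      haveI : IsProbabilityMeasure (prodBernoulli Ksp1) := inferInstance
      haveI : IsProbabilityMeasure (prodBernoulli Ksp) := inferInstance
      have e1 := real_openConn_attachPendant Ksp o t₀ hot₀ hisoKsp t₀ t hot₀.symm hto
      have c1 := probReal_compl_eq_one_sub (μ := prodBernoulli Ksp1) (MeasurableSet.of_discrete : MeasurableSet (openConn t₀ t : Set (BondConfig (Fin n))))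
      have c2 := probReal_compl_eq_one_sub (μ := prodBernoulli Ksp) (MeasurableSet.of_discrete : MeasurableSet (openConn t₀ t : Set (BondConfig (Fin n))))
      rw [c1]; change 1 - (prodBernoulli (fun f : Sym2 (Fin n) => if f = s(o, t₀) then 1 else Ksp f)).real (openConn t₀ t) = 0
      rw [e1, ← c2]; exact hconn t ht
    have h_ot : (prodBernoulli Ksp1).real (openConn o t)ᶜ = 0 := by
      have hsub : ((openConn o t)ᶜ : Set (BondConfig (Fin n))) ⊆ (openConn o t₀)ᶜ ∪ (openConn t₀ t)ᶜ := by
        intro ω hω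
        by_contra hc
        simp only [mem_union, mem_compl_iff, not_or, not_not] at hc
        exact hω ((hc.1 : (openGraph ω).Reachable o t₀).trans hc.2)
      apply le_antisymm _ measureReal_nonneg
      calc (prodBernoulli Ksp1).real (openConn o t)ᶜ ≤ (prodBernoulli Ksp1).real ((openConn o t₀)ᶜ ∪ (openConn t₀ t)ᶜ) :=
            measureReal_mono hsub (measure_ne_top _ _)
        _ ≤ (prodBernoulli Ksp1).real (openConn o t₀)ᶜ + (prodBernoulli Ksp1).real (openConn t₀ t)ᶜ := measureReal_union_le _ _
        _ = 0 := by rw [h_ot₀, h_t₀t, add_zero]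
    have h_to : (prodBernoulli Ksp1).real (openConn t o)ᶜ = 0 := by
      have : (openConn t o : Set (BondConfig (Fin n))) = openConn o t :=
        Set.ext fun _ => ⟨fun h => SimpleGraph.Reachable.symm h, fun h => SimpleGraph.Reachable.symm h⟩
      rw [this]; exact h_ot
    have hdiag : ∀ x : Fin n, (prodBernoulli Ksp1).real (openConn x x)ᶜ = 0 := by
      intro x
      have : ((openConn x x)ᶜ : Set (BondConfig (Fin n))) = ∅ := by
        ext ω; simp only [mem_compl_iff, mem_empty_iff_false, iff_false, not_not]
        exact (SimpleGraph.Reachable.refl x : (openGraph ω).Reachable x x)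
      rw [this, measureReal_empty]
    rcases Sym2.mem_iff.1 ha with ha' | ha' <;> rcases Sym2.mem_iff.1 hc with hc' | hc' <;> rw [ha', hc']
    · exact hdiag o
    · exact h_ot
    · exact h_to
    · exact hdiag t
  constructor
  · intro hz
    rw [← hA, hB]
    exact real_openConn_attachPendant Ksp o t₀ hot₀ hisoKsp z b hz hb
  · rw [← hA, hB]
    exact real_openConn_attachPendant_self Ksp o t₀ hot₀ hisoKsp b hb

end UpsetExchange

end

end Summit.CriticalPhenomena.PercolationContinuityZ3.Theorems
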